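import Mathlib.NumberTheory.ArithmeticFunction.Liouville
import Mathlib.Data.Set.Finite.Basic
import HarnessLib

/-!
# Sign changes of the Liouville function on `n² + d` (Srinivasan 2022)

Topic `NumberTheory/Multiplicative`. ONE named fact (not proved here) and its proved reading in the
`Ω`-parity vocabulary of the Parity routes.

> **Theorem (Srinivasan).** Let `f(x) = x² + d` where `d ≠ 0`. Then `λ(n² + d)` changes sign
> infinitely often.

Here `λ(n) = (−1)^{Ω(n)}` is the Liouville function (`ArithmeticFunction.liouville`). For a
`{±1}`-valued sequence «changes sign infinitely often» is the same as «takes each of the values `−1`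
and `+1` for infinitely many `n`», and that is how the fact is stated (`n ∈ ℕ`; the finitely many
`n` with `n² + d ≤ 0`, possible only for `d < 0`, are irrelevant: there `ℤ.toNat` gives `0` and
`λ 0 = 0 ≠ ±1`). The printed proof obtains ONE value `n₀² + d = d·M·k²` with `λ(dM) = −1` from the
genus theory of binary quadratic forms (an integer `M` with `λ(M) = −λ(d)` such that `(M, 0, −d)` is the
only ambiguous form of the principal genus of discriminant `4dM`, the fundamental unit having norm
`+1`), propagates it along the Pell conic `Mk² − dl² = ±1` (`n = dl`) to infinitely many `n`, and
concludes with the Borwein–Choi–Ganguli lemma («`−1` infinitely often ⇒ infinitely many sign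
changes»); the value `+1` infinitely often is the Pell orbit `n² + d = d·r²` (Lemma «`λ(n²+d) = λ(d)`
infinitely often») combined with the reductions to square-free positive `d`. The special case `d = 1`
is Borwein–Choi–Ganguli 2013, Thm. 1 (and is a 0-sorry theorem of the tree on the Summits side).
Numbering: the main theorem is «Theorem 1.3» in the sectioned numbering of Proc. AMS 150 (2022) /
the arXiv text's own cross-reference (§5: «our main result, Theorem 1.3»), «Theorem 3» in the flat
numbering of the arXiv:2104.15004 source as indexed here.

Main declarations:
* `Srinivasan2022_liouville_sq_add_const_signChanges` — the named fact;
* `Srinivasan2022_liouville_sq_add_const_signChanges.infinite_odd_cardFactors` /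
  `.infinite_even_cardFactors` — PROVED readings: infinitely many `n` with `1 < n² + d` and
  `Ω(n² + d)` odd (resp. even), the shape used by `Summit.Parity.BatemanHorn.Theses.OddParityLadder.OddSignQuad`
  on the cell `q = (x + b/2)² + D`.

## References
* [Srinivasan2022] A. Srinivasan, *Infinitely many sign changes of the Liouville function on x² + d*,
  Proc. Amer. Math. Soc. 150 (2022), 3799–3809; arXiv:2104.15004 — Theorem 1.3 (= «Theorem 3»).
* [BorweinChoiGanguli2013] P. Borwein, S. K. K. Choi, H. Ganguli, *Sign changes of the Liouville
  function on quadratics*, Canad. Math. Bull. 56 (2013), 251–257 — Theorem 1 (`d = 1`), Lemma used as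
  Srinivasan's Lemma 3.1.
-/

namespace Literature.NumberTheory.Multiplicative

open ArithmeticFunction

/-- **Srinivasan 2022, main theorem (Thm. 1.3; «Theorem 3» in the arXiv source's flat numbering), AS
PRINTED:** «Let `f(x) = x² + d` where `d ≠ 0`. Then `λ(n² + d)` changes sign infinitely often.» —
stated as: for every integer `d ≠ 0`, the Liouville function takes the value `−1` at `n² + d` for
infinitely many `n ∈ ℕ` AND the value `+1` for infinitely many `n ∈ ℕ` (equivalent, for the
eventually `{±1}`-valued sequence `λ(n² + d)`, to infinitely many sign changes).
[cite: Srinivasan2022, Thm. 1.3 (main theorem; «Theorem 3» of arXiv:2104.15004)] -/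
def Srinivasan2022_liouville_sq_add_const_signChanges : Prop :=
  ∀ d : ℤ, d ≠ 0 →
    Set.Infinite {n : ℕ | liouville (((n : ℤ) ^ 2 + d).toNat) = -1} ∧
      Set.Infinite {n : ℕ | liouville (((n : ℤ) ^ 2 + d).toNat) = 1}

namespace Srinivasan2022_liouville_sq_add_const_signChanges

/-- `λ m = −1` forces `m ≠ 0` and `Ω(m)` odd. [folklore] -/
private theorem odd_cardFactors_of_liouville_eq_neg_one {m : ℕ} (h : liouville m = -1) :
    Odd (cardFactors m) := by
  have hm : m ≠ 0 := by
    rintro rfl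
    simp at h
  rw [liouville_apply hm] at h
  rcases Nat.even_or_odd (cardFactors m) with he | ho
  · rw [he.neg_one_pow] at h
    norm_num at h
  · exact ho

/-- `λ m = 1` forces `Ω(m)` even. [folklore] -/
private theorem even_cardFactors_of_liouville_eq_one {m : ℕ} (h : liouville m = 1) :
    Even (cardFactors m) := by
  rcases Nat.eq_zero_or_pos m with rfl | hm
  · simp
  rw [liouville_apply hm.ne'] at h
  rcases Nat.even_or_odd (cardFactors m) with he | ho
  · exact he
  · rw [ho.neg_one_pow] at h
    norm_num at h

/-- For `n ≥ |d| + 2` one has `1 < n² + d`. [folklore] -/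
private theorem one_lt_sq_add_of_le {d : ℤ} {n : ℕ} (hn : d.natAbs + 2 ≤ n) : 1 < (n : ℤ) ^ 2 + d := by
  have h1 : (d.natAbs : ℤ) + 2 ≤ (n : ℤ) := by exact_mod_cast hn
  have h2 : -(d.natAbs : ℤ) ≤ d := by
    have := Int.natAbs_eq d
    omega
  nlinarith

/-- The sets of the fact, cut down to `n ≥ |d| + 2`, stay infinite. [folklore] -/
private theorem infinite_inter_ge {S : Set ℕ} (hS : S.Infinite) (N : ℕ) :
    (S ∩ {n | N ≤ n}).Infinite := by
  have hfin : (S ∩ {n | n < N}).Finite := (Set.finite_lt_nat N).subset Set.inter_subset_right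
  have hsplit : S = (S ∩ {n | N ≤ n}) ∪ (S ∩ {n | n < N}) := by
    ext n
    simp only [Set.mem_union, Set.mem_inter_iff, Set.mem_setOf_eq]
    constructor
    · intro hn
      rcases le_or_gt N n with h | h
      · exact Or.inl ⟨hn, h⟩
      · exact Or.inr ⟨hn, h⟩
    · rintro (⟨hn, -⟩ | ⟨hn, -⟩) <;> exact hn
  by_contra hinf
  exact hS ((hsplit ▸ (Set.not_infinite.1 hinf).union hfin))

/-- **Proved reading (odd parity).** From the fact: for every `d ≠ 0` there are infinitely many `n`
with `1 < n² + d` and `Ω(n² + d)` odd — i.e. `λ(n² + d) = −1` infinitely often, in the vocabulary of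
`OddSignQuad` for the monic even-`b` cell `(x + b/2)² + d`. [cite: Srinivasan2022, Thm. 1.3 (main theorem; «Theorem 3» of arXiv:2104.15004)] -/
theorem infinite_odd_cardFactors (h : Srinivasan2022_liouville_sq_add_const_signChanges) (d : ℤ)
    (hd : d ≠ 0) :
    Set.Infinite {n : ℕ | 1 < (n : ℤ) ^ 2 + d ∧ Odd (cardFactors (((n : ℤ) ^ 2 + d).toNat))} := by
  refine (infinite_inter_ge (h d hd).1 (d.natAbs + 2)).mono ?_
  rintro n ⟨hn, hN⟩
  exact ⟨one_lt_sq_add_of_le hN, odd_cardFactors_of_liouville_eq_neg_one hn⟩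

/-- **Proved reading (even parity).** From the fact: for every `d ≠ 0` there are infinitely many `n`
with `1 < n² + d` and `Ω(n² + d)` even — i.e. `λ(n² + d) = +1` infinitely often. [cite: Srinivasan2022, Thm. 1.3 (main theorem; «Theorem 3» of arXiv:2104.15004)] -/
theorem infinite_even_cardFactors (h : Srinivasan2022_liouville_sq_add_const_signChanges) (d : ℤ)
    (hd : d ≠ 0) :
    Set.Infinite {n : ℕ | 1 < (n : ℤ) ^ 2 + d ∧ Even (cardFactors (((n : ℤ) ^ 2 + d).toNat))} := by
  refine (infinite_inter_ge (h d hd).2 (d.natAbs + 2)).mono ?_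
  rintro n ⟨hn, hN⟩
  exact ⟨one_lt_sq_add_of_le hN, even_cardFactors_of_liouville_eq_one hn⟩

end Srinivasan2022_liouville_sq_add_const_signChanges

end Literature.NumberTheory.Multiplicative
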